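import Literature.AlgebraicGeometry.Frobenioids.KummerDualityOfCupProduct
import HarnessLib

/-!
# Frobenioids II, Thm. 2.4 (i): naturality of the cup-product duality isomorphism ("(γ₁)")

Mochizuki, *The geometry of Frobenioids II*, Kyushu J. Math. **62** (2008), §2, Thm. 2.4 (i) p. 19: the
isomorphisms `H¹((H₁)_{A₁}, μ_N(A₁)) ⥲ H¹((H₂)_{A₂}, μ_N(A₂))`, `F_N(A₁) ⥲ F_N(A₂)` induced by `Ψ` "are
compatible with the respective … reciprocity maps" [cite: MochizukiFrdII2008, Thm 2.4 (i) p.19] — whose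
kernel-precise content, for the duality isomorphism `H¹(H_A, μ_N(A)) ⥲ H_A^ab ⊗ F_N(A)` of Def. 2.2 p. 18, is
the square
  `recTargetMap ∘ ι₁ = ι₂ ∘ isoH1`   ("(γ₁)" of abc-iut-L1-d4, the hypothesis of its
  `PadicKummerSettingProofs` / `PadicKummerIsoKummerMaps`).
Cell abc-iut, cross-layer row **L1-γ₁**, milestone M3 (seat abc-iut-L2-t12). For the CONSTRUCTED
isomorphism `Kummer.dualityIsoOfCupProduct` (`KummerDualityOfCupProduct.lean`) this square is a THEOREM
for every isomorphism `e` of Definition 2.2 contexts (`PadicKummer.Def22Context.Iso`): cup products,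
`θ`, and the `H1 ≅ continuousCohomology 1` comparison are all natural —

* `Def22Context.Iso.h1MuEquiv_isoH1` — `h1MuEquiv (e.isoH1 c) = (e.transportMu N).push 1 (h1MuEquiv c)`;
* `Def22Context.Iso.push_homToH1Triv` — transport of `Hom(H_A^ab, ℤ/N) → H¹(H_A, ℤ/N)`;
* `Def22Context.Iso.dualTransport`, `cupDual_push`, `thetaHom_recTargetMap` — the transports of
  `Hom(Hom(H_A^ab, ℤ/N), F_N)` and the naturality of `cupDual` (from `isoFN_cupFN`) and of `θ`;
* **`Def22Context.Iso.recTargetMap_dualityIsoOfCupProduct`** — (γ₁):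
  `(e.thm24Data N).recTargetMap (ι₁ c) = ι₂ (e.isoH1 N c)` for `ιᵢ = dualityIsoOfCupProduct … hθᵢ hcupᵢ`.

Classical homological algebra; nothing here concerns [IUTchIII]; universe `0`.
-/

noncomputable section

namespace Literature.AlgebraicGeometry.Frobenioids

namespace PadicKummer

namespace Def22Context.Iso

open CategoryTheory groupCohomology Kummer Literature.NumberTheory.GaloisRepresentations
open scoped TensorProduct

variable {X₁ X₂ : Def22Context} (e : Def22Context.Iso X₁ X₂) (N : ℕ)

/-! ### Naturality of `h1MuEquiv` -/

/-- **The comparison `H1 ≅ continuousCohomology 1` is natural**: `h1MuEquiv (e.isoH1 c)` is the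
`H¹`-transport (push along `((H₂)_{A₂} ⥲ (H₁)_{A₁}, μ_N(A₁) ⥲ μ_N(A₂))`) of `h1MuEquiv c`.
[cite: MochizukiFrdII2008, Thm 2.4 (i) p.19] -/
theorem h1MuEquiv_isoH1 (c : H1 (Rep.ofMulDistribMulAction X₁.HA (Mu N X₁.O))) :
    h1MuEquiv N X₂.O X₂.HA (e.isoH1 N c) =
      ((e.transportMu N).push 1).hom (h1MuEquiv N X₁.O X₁.HA c) := by
  induction c using H1_induction_on with
  | h κ =>
    rw [isoH1_H1π, h1MuEquiv_H1π, h1MuEquiv_H1π]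
    change _ = ContinuousCohomology.map e.haInv (e.transportMu N).f' 1 _
    rw [map_oneCocycleClass]
    exact congrArg _ (Subtype.ext (ContinuousMap.ext fun h => rfl))

/-! ### Transport of `Hom(H_A^ab, ℤ/N)` and of `Hom(Hom(H_A^ab, ℤ/N), F_N)` -/

/-- `H_{A₁}^ab → H_{A₂}^ab` (additively), induced by `(H₁)_{A₁} ⥲ (H₂)_{A₂}` — the first tensor factor of
`Thm24Data.recTargetMap`. [cite: MochizukiFrdII2008, Thm 2.4 (i) p.19] -/
def abHom : Additive (Abelianization X₁.HA) →+ Additive (Abelianization X₂.HA) :=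
  MonoidHom.toAdditive (Abelianization.map e.isoHA.toMonoidHom)

/-- `abHom` on a class `[h]`. [cite: MochizukiFrdII2008, Thm 2.4 (i) p.19] -/
@[simp] theorem abHom_ofMul_of (h : X₁.HA) :
    e.abHom (Additive.ofMul (Abelianization.of h)) = Additive.ofMul (Abelianization.of (e.isoHA h)) := rfl

/-- **Transport of `Hom(H_A^ab, ℤ/N) → H¹(H_A, ℤ/Nℤ)`**: the push of `[χ₂ ∘ abHom]` is `[χ₂]`.
[cite: MochizukiFrdII2008, Thm 2.4 (i) p.19] -/
theorem push_homToH1Triv (χ₂ : Additive (Abelianization X₂.HA) →+ ZMod N) :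
    ((e.transportTriv N).push 1).hom (homToH1Triv N X₁.HA (χ₂.comp e.abHom)) = homToH1Triv N X₂.HA χ₂ := by
  rw [homToH1Triv_apply, homToH1Triv_apply]
  change ContinuousCohomology.map e.haInv (e.transportTriv N).f' 1 _ = _
  rw [map_oneCocycleClass]
  refine congrArg _ (Subtype.ext (ContinuousMap.ext fun h => ?_))
  change χ₂ (e.abHom (Additive.ofMul (Abelianization.of (e.isoHA.symm h)))) =
    χ₂ (Additive.ofMul (Abelianization.of h))
  rw [abHom_ofMul_of, MulEquiv.apply_symm_apply]

/-- **Transport of `Hom(Hom(H_A^ab, ℤ/N), F_N)`** along `e`: `ψ ↦ (χ₂ ↦ e.isoFN (ψ (χ₂ ∘ abHom)))`.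
[cite: MochizukiFrdII2008, Thm 2.4 (i) p.19] -/
def dualTransport : ((Additive (Abelianization X₁.HA) →+ ZMod N) →+ FN X₁ N) →+
    ((Additive (Abelianization X₂.HA) →+ ZMod N) →+ FN X₂ N) where
  toFun ψ :=
    { toFun := fun χ₂ => e.isoFN N (ψ (χ₂.comp e.abHom))
      map_zero' := by
        rw [AddMonoidHom.zero_comp, map_zero, map_zero]
      map_add' := fun χ χ' => by
        rw [AddMonoidHom.add_comp, map_add, map_add] }
  map_zero' := by ext; simp
  map_add' ψ ψ' := by ext; simp

/-- Unfolding `dualTransport`. [cite: MochizukiFrdII2008, Thm 2.4 (i) p.19] -/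
@[simp] theorem dualTransport_apply (ψ : (Additive (Abelianization X₁.HA) →+ ZMod N) →+ FN X₁ N)
    (χ₂ : Additive (Abelianization X₂.HA) →+ ZMod N) :
    e.dualTransport N ψ χ₂ = e.isoFN N (ψ (χ₂.comp e.abHom)) := rfl

/-- **Naturality of `cupDual`**: `cupDual (push x) = dualTransport (cupDual x)` — from the cup-product
naturality `isoFN_cupFN` and `push_homToH1Triv`. [cite: MochizukiFrdII2008, Thm 2.4 (i) p.19] -/
theorem cupDual_push (x : continuousCohomology 1 (muTopRep N X₁.O X₁.HA)) :
    cupDual N X₂.O X₂.HA X₂.qHA (((e.transportMu N).push 1).hom x) =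
      e.dualTransport N (cupDual N X₁.O X₁.HA X₁.qHA x) := by
  refine AddMonoidHom.ext fun χ₂ => ?_
  rw [cupDual_apply, dualTransport_apply, cupDual_apply, ← push_homToH1Triv, isoFN_cupFN]

/-- `F_N(A₁) ⥲ F_N(A₂)` commutes with the `ℤ/Nℤ`-actions. [cite: MochizukiFrdII2008, Thm 2.4 (i) p.19] -/
theorem isoFN_zmodSMul (c : ZMod N) (φ : FN X₁ N) :
    e.isoFN N (letI := FN.zmodModule N X₁.O X₁.HA X₁.qHA; c • φ) =
      (letI := FN.zmodModule N X₂.O X₂.HA X₂.qHA; c • e.isoFN N φ) :=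
  letI := FN.zmodModule N X₁.O X₁.HA X₁.qHA
  letI := FN.zmodModule N X₂.O X₂.HA X₂.qHA
  ZMod.map_smul (e.isoFN N).toAddMonoidHom c φ

/-- Naturality of `θ` as an identity of `ℤ`-linear maps out of the tensor product.
[cite: MochizukiFrdII2008, Thm 2.4 (i) p.19] -/
theorem lift_thetaBilin_comp_recTargetMap :
    (TensorProduct.lift (thetaBilin N X₂.O X₂.HA X₂.qHA)).comp (e.thm24Data N).recTargetMap =
      (e.dualTransport N).toIntLinearMap.comp (TensorProduct.lift (thetaBilin N X₁.O X₁.HA X₁.qHA)) := by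
  refine TensorProduct.ext' fun a φ => ?_
  refine AddMonoidHom.ext fun χ₂ => ?_
  have hmap : (e.thm24Data N).recTargetMap (a ⊗ₜ φ) = e.abHom a ⊗ₜ e.isoFN N φ := by
    simp only [Thm24Data.recTargetMap, TensorProduct.map_tmul]
    rfl
  change thetaHom N X₂.O X₂.HA X₂.qHA ((e.thm24Data N).recTargetMap (a ⊗ₜ φ)) χ₂ =
    e.dualTransport N (thetaHom N X₁.O X₁.HA X₁.qHA (a ⊗ₜ φ)) χ₂
  rw [hmap, thetaHom_tmul, dualTransport_apply, thetaHom_tmul]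
  exact (e.isoFN_zmodSMul N ((χ₂.comp e.abHom) a) φ).symm

/-- **Naturality of `θ`**: `θ₂ ∘ recTargetMap = dualTransport ∘ θ₁`.
[cite: MochizukiFrdII2008, Thm 2.4 (i) p.19] -/
theorem thetaHom_recTargetMap (t : RecTarget N X₁.O X₁.HA X₁.qHA) :
    thetaHom N X₂.O X₂.HA X₂.qHA ((e.thm24Data N).recTargetMap t) =
      e.dualTransport N (thetaHom N X₁.O X₁.HA X₁.qHA t) :=
  LinearMap.congr_fun (e.lift_thetaBilin_comp_recTargetMap N) t

/-! ### (γ₁) -/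

/-- **Theorem 2.4 (i), naturality of the duality isomorphism ("(γ₁)")**: for the cup-product duality
isomorphisms `ιᵢ = dualityIsoOfCupProduct …` of the two contexts,
`recTargetMap ∘ ι₁ = ι₂ ∘ isoH1` along every isomorphism `e` of Definition 2.2 contexts — the hypothesis
of abc-iut-L1-d4's Thm. 2.4 (i) discharge, PROVED for the constructed isomorphism.
[cite: MochizukiFrdII2008, Thm 2.4 (i) p.19] -/
theorem recTargetMap_dualityIsoOfCupProduct
    (hθ₁ : Function.Bijective (thetaHom N X₁.O X₁.HA X₁.qHA))
    (hcup₁ : Function.Bijective (cupDual N X₁.O X₁.HA X₁.qHA))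
    (hθ₂ : Function.Bijective (thetaHom N X₂.O X₂.HA X₂.qHA))
    (hcup₂ : Function.Bijective (cupDual N X₂.O X₂.HA X₂.qHA))
    (c : H1 (Rep.ofMulDistribMulAction X₁.HA (Mu N X₁.O))) :
    (e.thm24Data N).recTargetMap
        ((dualityIsoOfCupProduct N X₁.O X₁.HA X₁.qHA hθ₁ hcup₁).toAddEquiv c) =
      (dualityIsoOfCupProduct N X₂.O X₂.HA X₂.qHA hθ₂ hcup₂).toAddEquiv (e.isoH1 N c) := by
  apply hθ₂.1
  rw [thetaHom_recTargetMap, thetaHom_dualityIsoOfCupProduct, thetaHom_dualityIsoOfCupProduct,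
    h1MuEquiv_isoH1, cupDual_push]

end Def22Context.Iso

end PadicKummer

end Literature.AlgebraicGeometry.Frobenioids
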